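import Summits.PneNP.PneNP.Theses.RamseyAliens
import Summits.PneNP.PneNP.Theorems.SzkEntropyPhCollapse

/-!
# Route RamseyAliens — `DecisionAssembly` (stmt-PneNP-2279)

The certified spine of the headline form: `P_bool_eq → NP_bool_eq → P_subset_NP → RamseySigmaTwo → RamseyNotP → PneNP`.
If Cook's `PneNP` failed, the bridges give `Nondeterministic.NP ⊆ Classes.P`, hence `Σ₂ᵖ ⊆ P`
(`SigmaP_subset_P_of_NP_subset_P`, the collapse of the hierarchy), so `L_R ∈ Σ₂ᵖ` would be in `P`, contradicting
`RamseyNotP`.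
-/

set_option linter.dupNamespace false -- `Summit.PneNP.PneNP.…`: summit = sub-problem name (D-0017 single-conjunct layout)

namespace Summit.PneNP.PneNP.Theorems

open Literature.Computability.Complexity

/-- **Support item `DecisionAssembly` of route RamseyAliens (stmt-PneNP-2279)**:
`P_bool_eq → NP_bool_eq → P_subset_NP → RamseySigmaTwo → RamseyNotP → PneNP` — under `¬PneNP` the hierarchy collapses to
`P` (`Σ₂ᵖ ⊆ P`), putting the Ramsey language `L_R ∈ Σ₂ᵖ` in `P`. [cite: AroraBarakCC2009, Thm 5.4] [folklore] -/
theorem ramseyAliens_decisionAssembly_proof : Summit.PneNP.PneNP.Theses.RamseyAliens.DecisionAssembly := by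
  unfold Summit.PneNP.PneNP.Theses.RamseyAliens.DecisionAssembly Summit.PneNP.PneNP.Theses.RamseyAliens.RamseySigmaTwo
    Summit.PneNP.PneNP.Theses.RamseyAliens.RamseyNotP
  intro hP hN _ hS2 hR
  unfold Literature.Computability.Complexity.P_bool_eq at hP
  unfold Literature.Computability.Complexity.NP_bool_eq at hN
  by_contra hcon
  have hsub : Nondeterministic.NP ⊆ Classes.P := by
    intro L hL
    by_contra hLP
    refine hcon ⟨L, ?_, ?_⟩
    · rw [hN]; exact hL
    · rw [hP]; exact hLP
  exact hR (SigmaP_subset_P_of_NP_subset_P hsub 2 hS2)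

end Summit.PneNP.PneNP.Theorems
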